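import Summits.CriticalPhenomena.SAWScalingLimit.Theorems.SAWReversalUpgradePathUpgradeRCoreB

/-!
# `PathUpgradeR`, line `bidir_windows`, the lead's stub `stub_returnsDie` — part 2a: instantiation helpers
(crux stmt-CriticalPhenomena-18055, route `SAWReversalUpgrade`)

Generic order/metric lemmas used by the per-sample instantiation `PathUpgradeRInst.inst`: monotonicity of the
curve parameter of initial/final segments in the capacity parameter, farness of the three points of an
`(ℓ, ε)`-return from the endpoints given the four "window" exclusions, and the transfer of conformal farness of a
porosity point to the backward reference arc. [folklore]
-/

noncomputable section

open Set Metric Filter Topology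
open scoped unitInterval NNReal

namespace Summit.CriticalPhenomena.SAWScalingLimit.Theorems.PathUpgradeRInst

open Literature.Probability.RandomPlanarGeometry

/-- If the initial segments `X[0,u]`, `X[0,u']` of a simple curve are the images `F[0,t] ⊆ F[0,t']`, then
`u ≤ u'`. [folklore] -/
theorem le_of_image_Icc_zero_eq (X : Curve ℂ) (hXinj : Function.Injective X) (F : ℝ≥0 → ℂ) {t t' : ℝ≥0}
    {u u' : I} (htt' : t ≤ t') (hu : X '' Icc 0 u = F '' Icc 0 t) (hu' : X '' Icc 0 u' = F '' Icc 0 t') :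
    u ≤ u' := by
  have h1 : X u ∈ X '' Icc 0 u' := by
    rw [hu']
    have : X u ∈ F '' Icc 0 t := by
      rw [← hu]
      exact ⟨u, ⟨u.2.1, le_rfl⟩, rfl⟩
    obtain ⟨s, hs, hsu⟩ := this
    exact ⟨s, ⟨hs.1, hs.2.trans htt'⟩, hsu⟩
  obtain ⟨v, hv, hvu⟩ := h1
  rw [← hXinj hvu]
  exact hv.2

/-- If the final segments `X[u,1]`, `X[u',1]` of a simple curve are the images `F[0,t] ⊆ F[0,t']`, then
`u' ≤ u`. [folklore] -/
theorem le_of_image_Icc_one_eq (X : Curve ℂ) (hXinj : Function.Injective X) (F : ℝ≥0 → ℂ) {t t' : ℝ≥0}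
    {u u' : I} (htt' : t ≤ t') (hu : X '' Icc u 1 = F '' Icc 0 t) (hu' : X '' Icc u' 1 = F '' Icc 0 t') :
    u' ≤ u := by
  have h1 : X u ∈ X '' Icc u' 1 := by
    rw [hu']
    have : X u ∈ F '' Icc 0 t := by
      rw [← hu]
      exact ⟨u, ⟨le_rfl, u.2.2⟩, rfl⟩
    obtain ⟨s, hs, hsu⟩ := this
    exact ⟨s, ⟨hs.1, hs.2.trans htt'⟩, hsu⟩
  obtain ⟨v, hv, hvu⟩ := h1
  rw [← hXinj hvu]
  exact hv.1

/-- FARNESS OF A RETURN. If the curve avoids the four window events (no re-approach of `a` after leaving it, no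
far excursion after approaching `b`, at two pairs of scales), the three points `s₀ < u₀ < t₀` of an
`(ℓ, ε)`-return (`ℓ ≤ |X s₀ - X u₀|`, `|X s₀ - X t₀| ≤ ε`) are at distance `≥ raF` from `a` and `≥ rbF` from `b`
(where needed). [folklore] -/
theorem far_of_return (X : Curve ℂ) (a b : ℂ) {s₀ u₀ t₀ : I} {ℓ ε ra rb ra' rb' raF rbF : ℝ}
    (nB1 : ∀ s t : I, s < t → ℓ / 2 ≤ dist (X s) a → ra < dist (X t) a)
    (nB2 : ∀ s t : I, s < t → dist (X s) b ≤ rb → dist (X t) b < ℓ / 2)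
    (nB3 : ∀ s t : I, s < t → ra / 4 ≤ dist (X s) a → ra' < dist (X t) a)
    (nB4 : ∀ s t : I, s < t → dist (X s) b ≤ rb' → dist (X t) b < rb / 4)
    (hsu : s₀ < u₀) (hut : u₀ < t₀) (hfar : ℓ ≤ dist (X s₀) (X u₀)) (hret : dist (X s₀) (X t₀) ≤ ε)
    (hraF4 : raF ≤ ra / 4) (hraF' : raF ≤ ra') (hrbF4 : rbF ≤ rb / 4) (hrbF' : rbF ≤ rb')
    (hraℓ : ra ≤ ℓ) (hrbℓ : rb ≤ ℓ) (hεra : ε ≤ ra / 4) (hεrb : ε ≤ rb / 4) (hra : 0 < ra) (hrb : 0 < rb) :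
    rbF ≤ dist (X s₀) b ∧ raF ≤ dist (X u₀) a ∧ rbF ≤ dist (X u₀) b ∧ raF ≤ dist (X t₀) a ∧
      rbF ≤ dist (X t₀) b := by
  have hsa : ra / 2 ≤ dist (X s₀) a := by
    by_contra h
    push Not at h
    have h1 : ℓ / 2 ≤ dist (X u₀) a := by
      have := dist_triangle (X s₀) a (X u₀)
      rw [dist_comm a (X u₀)] at this
      linarith
    have h2 := nB1 u₀ t₀ hut h1
    have h3 := dist_triangle (X t₀) (X s₀) a
    rw [dist_comm (X t₀) (X s₀)] at h3
    linarith
  have hsb : rb / 2 ≤ dist (X s₀) b := by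
    by_contra h
    push Not at h
    have h2 := nB2 s₀ u₀ hsu (by linarith)
    have := dist_triangle (X s₀) b (X u₀)
    rw [dist_comm b (X u₀)] at this
    linarith
  have h4a : dist (X s₀) a ≤ dist (X s₀) (X t₀) + dist (X t₀) a := dist_triangle _ _ _
  have h4b : dist (X s₀) b ≤ dist (X s₀) (X t₀) + dist (X t₀) b := dist_triangle _ _ _
  have hta : raF ≤ dist (X t₀) a := by linarith
  have htb : rbF ≤ dist (X t₀) b := by linarith
  have hua : raF ≤ dist (X u₀) a := hraF'.trans (nB3 s₀ u₀ hsu (by linarith)).le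
  have hub : rbF ≤ dist (X u₀) b := by
    by_contra h
    push Not at h
    have := nB4 u₀ t₀ hut (by linarith)
    linarith
  exact ⟨by linarith, hua, hub, hta, htb⟩

/-- TRANSFER OF FARNESS TO THE BACKWARD REFERENCE. A point `e` with `|e - b| ≥ rbP` at conformal distance `≥ d'`
from the forward reference arc `r[0,T+1]` and from `Fr` is at distance `≥ d''` from the backward reference arc
`r'[0,T'+1]`: a point of the latter is `ε'`-close to a point `X v` of the final segment `X[ubot,1]`, which is
either in the initial segment `X[0,utop]` (then `ε`-close to the forward arc) or past `utop` (then within `rbW`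
of `b`). [folklore] -/
theorem le_infDist_bwd (X : Curve ℂ) (Xf Xb r r' : ℝ≥0 → ℂ) (hXf : Continuous Xf) (hXb : Continuous Xb)
    (hr : Continuous r) (hr' : Continuous r') {T T' : ℝ≥0} {utop ubot : I}
    (htop : X '' Icc 0 utop = Xf '' Icc 0 (T + 1)) (hbot : X '' Icc ubot 1 = Xb '' Icc 0 (T' + 1))
    {ε ε' d' d'' rbP rbW : ℝ} {b e : ℂ} {Fr : Set ℂ}
    (shF : hausdorffDist (Xf '' Icc 0 (T + 1)) (r '' Icc 0 (T + 1)) ≤ ε)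
    (shB : hausdorffDist (Xb '' Icc 0 (T' + 1)) (r' '' Icc 0 (T' + 1)) ≤ ε')
    (Wf0 : ∀ v : I, utop < v → dist (X v) b < rbW) (he' : d' ≤ infDist e (r '' Icc 0 (T + 1) ∪ Fr))
    (heb : rbP ≤ dist e b) (hd''1 : d'' ≤ d' - ε - ε') (hd''2 : d'' ≤ rbP - rbW - ε') (hd''3 : d'' ≤ d') :
    d'' ≤ infDist e (r' '' Icc 0 (T' + 1) ∪ Fr) := by
  have hne : (r' '' Icc 0 (T' + 1) ∪ Fr).Nonempty := ⟨r' 0, Or.inl ⟨0, ⟨le_rfl, bot_le⟩, rfl⟩⟩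
  refine (le_infDist hne).2 ?_
  rintro z (⟨u', hu', rfl⟩ | hz)
  · obtain ⟨x, hx, hxz⟩ := PathUpgradeRCore.exists_mem_dist_le_of_hausdorffDist_le'
      (isCompact_Icc.image hXb) (isCompact_Icc.image hr')
      (by rw [← hbot]; exact ⟨X ubot, ubot, ⟨le_rfl, ubot.2.2⟩, rfl⟩) shB ⟨u', hu', rfl⟩
    rw [← hbot] at hx
    obtain ⟨v, hv, rfl⟩ := hx
    rcases le_or_gt v utop with hvt | hvt
    · have hmem : X v ∈ Xf '' Icc 0 (T + 1) := by
        rw [← htop]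
        exact ⟨v, ⟨v.2.1, hvt⟩, rfl⟩
      obtain ⟨q, hq, hxq⟩ := PathUpgradeRCore.exists_mem_dist_le_of_hausdorffDist_le
        (isCompact_Icc.image hXf) (isCompact_Icc.image hr) ⟨r 0, 0, ⟨le_rfl, bot_le⟩, rfl⟩ shF hmem
      have h1 : d' ≤ dist e q := he'.trans (infDist_le_dist_of_mem (Or.inl hq))
      have h2 := dist_triangle4 e (r' u') (X v) q
      rw [dist_comm (r' u') (X v)] at h2
      linarith
    · have h1 := Wf0 v hvt
      have h2 := dist_triangle4 e (r' u') (X v) b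
      rw [dist_comm (r' u') (X v)] at h2
      linarith
  · exact hd''3.trans (he'.trans (infDist_le_dist_of_mem (Or.inr hz)))

end Summit.CriticalPhenomena.SAWScalingLimit.Theorems.PathUpgradeRInst

namespace Summit.CriticalPhenomena.SAWScalingLimit.Theorems

/-- Registered auxiliary stub `stub_returnsDie_instA` of crux stmt-CriticalPhenomena-18055 (line `bidir_windows`):
monotonicity of the curve parameter of initial segments (`PathUpgradeRInst.le_of_image_Icc_zero_eq`). [folklore] -/
theorem stub_returnsDie_instA : ∀ (X : Literature.Probability.RandomPlanarGeometry.Curve ℂ), Function.Injective X → ∀ (F : NNReal → ℂ) (t t' : NNReal) (u u' : unitInterval), t ≤ t' → X '' Set.Icc 0 u = F '' Set.Icc 0 t → X '' Set.Icc 0 u' = F '' Set.Icc 0 t' → u ≤ u' :=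
  fun X hXinj F _ _ _ _ htt' hu hu' => PathUpgradeRInst.le_of_image_Icc_zero_eq X hXinj F htt' hu hu'

end Summit.CriticalPhenomena.SAWScalingLimit.Theorems

end
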